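import Literature.MathematicalPhysics.QuantumManyBody.WeightedCorrector

/-!
Sketch for crux-ideate stmt-AtomisticToContinuum-12057 (StaticResponseBound), ideator 3, round 1.
First lemmas of the two idea cards (they only need to ELABORATE; proofs are for provers).
-/

noncomputable section

open MeasureTheory
open scoped ENNReal BigOperators

namespace Summit.AtomisticToContinuum.BoseEinsteinCondensation.Cruxes.StaticResponseBound.Sketch

open Literature.MathematicalPhysics.QuantumManyBody.BoseGas

/-- Card `fibre-centering-free-branch`, first lemma: THOMSON (Kelvin) PRINCIPLE, flux side, for the
Kipnis–Varadhan `H₋₁` norm of the tree (`hMinusOneSqW`). If a `C¹` periodic flux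
`J = (J_{i,k})` on the `N`-particle torus transports the charge `g F²` weakly,
`∫ g φ F² = -∫ (J·∇φ) F²` for every periodic test `φ`, then `‖g‖²₋₁ ≤ ∫ |J|² F²`.
(One Cauchy–Schwarz: `2∫gφF² - 𝓔(φ,φ) = -2∫J·∇φF² - ∫|∇φ|²F² ≤ ∫|J|²F²`.) -/
def ThomsonDual : Prop :=
  ∀ (N : ℕ) (L : ℝ) (F g : Config N → ℝ) (J : Fin N → Fin 3 → Config N → ℝ),
    0 < L → Continuous F → (∀ i k, IsPeriodicTest L (J i k)) →
    (∀ φ : Config N → ℝ, IsPeriodicTest L φ →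
      ∫ X in cellN N L, g X * φ X * F X ^ 2 =
        -∫ X in cellN N L, (∑ i, ∑ k, J i k X * pderiv i k φ X) * F X ^ 2) →
    hMinusOneSqW L F g ≤ ENNReal.ofReal (∫ X in cellN N L, (∑ i, ∑ k, J i k X ^ 2) * F X ^ 2)

/-- Card `fibre-centering-free-branch`, second lemma (the lever): FIBRE SUB-ADDITIVITY of `H₋₁` for
conditionally centred one-particle charges. If each `θ i` is centred in the fibre of particle `i`
(its integral against `F²` over the cell in the variable `x_i`, all other particles frozen, vanishes)
and admits the fibre bound `(∫ θ_i φ F²)² ≤ c_i · ∫ |∇_i φ|² F²` for every periodic test `φ`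
(`c_i` = bath-averaged fibre resistance), then `‖∑ θ_i‖²₋₁ ≤ ∑ c_i` for the FULL form
(Cauchy–Schwarz over particles: the Dirichlet form is the sum of the fibre forms). -/
def FibreSubadditivity : Prop :=
  ∀ (N : ℕ) (L : ℝ) (F : Config N → ℝ) (θ : Fin N → Config N → ℝ) (c : Fin N → ℝ),
    0 < L → Continuous F → (∀ i, 0 ≤ c i) →
    (∀ i, ∀ φ : Config N → ℝ, IsPeriodicTest L φ →
      (∫ X in cellN N L, θ i X * φ X * F X ^ 2) ^ 2 ≤
        c i * ∫ X in cellN N L, (∑ k, pderiv i k φ X ^ 2) * F X ^ 2) →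
    hMinusOneSqW L F (fun X => ∑ i, θ i X) ≤ ENNReal.ofReal (∑ i, c i)

/-- Card `feynman-defect-screened-flux`, first lemma: the REGRESSION SUM RULE behind the screened
flux. For a positive `C¹` periodic weight `F` (think `F = Ψ₀`), the density wave
`G = ∑_j cos(p k·x_j)` (`p = 2π/L`) and the drift wave
`D = ∑_j sin(p k·x_j) (k·∇_j F) F` (`= ½ ∑_j sin θ_j (k·∇_j)(F²)`), one integration by parts on the
torus gives `∫ G·D = (p|k|²/2) (∫ F² ∑_j sin² θ_j - ∫ F² G²)`: the `L²(F²dX)`-regression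
coefficient of the drift wave on the density wave is EXACTLY `⟨∑ sin²⟩/⟨G²⟩ - 1 = 1/S(p) - 1`
(Feynman's energy divided by `p²`, minus one), for every translation-invariant weight. -/
def RegressionSumRule : Prop :=
  ∀ (N : ℕ) (L : ℝ) (k : Fin 3 → ℤ) (F : Config N → ℝ), 0 < L → IsPeriodicTest L F →
    let p : ℝ := 2 * Real.pi / L
    let θ : Fin N → Config N → ℝ := fun j X => p * ∑ i, (k i : ℝ) * X j i
    let G : Config N → ℝ := fun X => ∑ j, Real.cos (θ j X)
    let D : Config N → ℝ := fun X => ∑ j, Real.sin (θ j X) * (∑ i, (k i : ℝ) * pderiv j i F X) * F X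
    ∫ X in cellN N L, G X * D X =
      p * (∑ i, (k i : ℝ) ^ 2) / 2 *
        ((∫ X in cellN N L, (∑ j, Real.sin (θ j X) ^ 2) * F X ^ 2) -
          ∫ X in cellN N L, G X ^ 2 * F X ^ 2)

/-- Card `feynman-defect-screened-flux`, second lemma (the bookkeeping of the screened Thomson flux):
if `w = -L_F δ` weakly (`IsWeakCorrector L F w δ`, so `‖w‖²₋₁ = 𝓔_F(δ,δ)`) and `g = s (w + r)`
pointwise for a real `s`, then `‖g‖²₋₁ ≤ 2 s² 𝓔_F(δ,δ) + 2 s² ‖r‖²₋₁`. Applied with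
`g = G` (density wave), `δ = G/p²`, `s = S⋆` (trial structure factor) and `r` = the Feynman defect
`𝒲 - (1/S⋆ - 1) G`, it is the inequality `m₋₁ ≤ N S⋆²/p² + 2 S⋆² ‖R‖²₋₁` of the card. -/
def ScreenedFluxBound : Prop :=
  ∀ (N : ℕ) (L : ℝ) (F g w r δ : Config N → ℝ) (s : ℝ), 0 < L → Continuous F →
    IsWeakCorrector L F w δ → (∀ X, g X = s * (w X + r X)) →
    hMinusOneSqW L F g ≤
      ENNReal.ofReal (2 * s ^ 2 * dirichletFormW L F δ δ) + ENNReal.ofReal (2 * s ^ 2) * hMinusOneSqW L F r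

end Summit.AtomisticToContinuum.BoseEinsteinCondensation.Cruxes.StaticResponseBound.Sketch

end
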